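import Literature.InformationTheory.QuantumCodes.SpaceTimePolygons
import Literature.InformationTheory.QuantumCodes.ToricCodePhenomenologicalClusterBound
import HarnessLib

/-!
# Failure of minimum-weight space-time decoding of the toric code forces a long, half-faulty
# self-avoiding polygon (Dennis–Kitaev–Landahl–Preskill 2002, §5.2 — noisy syndrome measurement)

Topic `Literature/InformationTheory/QuantumCodes` (venture QEC, LADDER-QEC rung Q5, PARTITION row 09
"phenomenological"). Second theorem file towards the discharge of
`ToricCode.phenomFailureProb_le_of_sawCountBound` (`ToricCodePhenomenological.lean`, qec-type-09);
the space-time twin of `ToricCodePolygonExtraction.lean` (qec-lit-2).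

DKLP §5.2 (with §4.3, §6.1): if minimum-weight recovery `E_min` of the error history `E` fails, the
space-time cycle `E + E_min` has homologically non-trivial projection onto the final time slice, so
it contains a self-avoiding closed loop whose projection is non-trivial; "At a minimum, the
homologically nontrivial (self-avoiding) path must contain at least `L` horizontal links", and by
minimality at least half of its links are faulty (eq. (e_ineq)). Proved here:

* (imported from qec-lit-2's `ToricCodePhenomenologicalClusterBound.lean`: the projection `Π` onto
  the final slice does not increase the number of links and maps space-time cycles to toric cycles,
  whence `le_hammingNorm_of_stCycle_not_trivial`: a space-time cycle with non-trivial projection has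
  `≥ L` links, by `cycle_weight_ge_holds`; and `stTrivialSubmodule`: the harmless histories form a
  subspace);
* `even_card_filter_of_mem_stCycles` — a space-time cycle meets every site an even number of times;
* `exists_stPolygon_subset` — a non-empty set of links of the window meeting every site evenly
  contains a self-avoiding polygon (longest self-avoiding lattice path inside the set);
* `exists_stPolygon_not_mem_stTrivial` — a space-time cycle with non-trivial projection contains a
  self-avoiding polygon with non-trivial projection (peel polygons off; `stTrivial` is a subspace);
* `card_supp_le_two_mul_card_inter` — the half-weight inequality from minimality (eq. (e_ineq));
* **`exists_stPolygon_of_failure`** — failure of a minimum-weight space-time decoder on `E`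
  yields a self-avoiding polygon of the window with `ℓ ≥ L` links (its history is a space-time
  cycle with non-trivial projection) at least half of which are in `E`.

## References

* [DennisEtAl2002] E. Dennis, A. Kitaev, A. Landahl, J. Preskill, *Topological quantum memory*,
  J. Math. Phys. 43 (2002) 4452–4505, arXiv:quant-ph/0110143, §4.3 (success iff `E + E'`
  homologically trivial), §5.2 (eqs. (e_ineq)–(saw_L); "at least `L` horizontal links"), §6.1
  (the projection `Π` onto the final time slice).
-/

namespace Literature.InformationTheory.QuantumCodes

namespace ToricCode

open Finset Matrix
open Literature.Probability.LatticeModels (TorusSite Site Torus.proj)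
open Literature.Probability.Percolation (stepVec)
open Literature.Probability.RandomPlanarGeometry.SAW.Zd

variable {L T : ℕ}

/-! ### Arithmetic of `ℤ₂` and supports -/

/-- A non-zero element of `ℤ₂` is `1`. [folklore] -/
private theorem zmod2_eq_one_of_ne_zero {x : ZMod 2} (h : x ≠ 0) : x = 1 := by
  revert x; decide

/-- `x + y = 0 → x = y` in `ℤ₂`. [folklore] -/
private theorem zmod2_eq_of_add_eq_zero {x y : ZMod 2} (h : x + y = 0) : x = y := by
  revert x y; decide

/-- If `a + b ≠ 0` in `ℤ₂` then exactly one of them vanishes. [folklore] -/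
private theorem zmod2_eq_zero_iff_of_add_ne_zero {a b : ZMod 2} (h : a + b ≠ 0) : a = 0 ↔ b ≠ 0 := by
  revert a b; decide

/-- `a + a = 0` in `ℤ₂`. [folklore] -/
private theorem zmod2_add_self (a : ZMod 2) : a + a = 0 := by
  revert a; decide

/-- Membership in the support. [folklore] -/
private theorem mem_supp' {V : Type*} [Fintype V] {x : V → ZMod 2} {v : V} : v ∈ supp x ↔ x v ≠ 0 := by
  simp [supp]

/-- A binary vector is the sum of the indicators of its support. [cite: DennisEtAl2002, §4.4 (n_E(ℓ) ∈ {0,1})] -/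
private theorem eq_sum_single_supp {V : Type*} [Fintype V] [DecidableEq V] (c : V → ZMod 2) :
    c = ∑ ℓ ∈ supp c, (Pi.single ℓ (1 : ZMod 2) : V → ZMod 2) := by
  funext ℓ'
  rw [Finset.sum_apply]
  simp only [Pi.single_apply]
  rw [Finset.sum_ite_eq]
  split_ifs with h
  · exact zmod2_eq_one_of_ne_zero (mem_supp'.1 h)
  · by_contra h'
    exact h (mem_supp'.2 h')

/-! ### Even degrees -/

/-- **A space-time cycle meets every site an even number of times** (`L ≥ 2`): for `c ∈ stCycles`,
the number of links of `c` (embedded in the ambient lattice) having the ambient site `y` as an end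
site is even. [cite: DennisEtAl2002, §4.3 (a cycle has no boundary)] -/
theorem even_card_filter_of_mem_stCycles [NeZero L] (hL : 2 ≤ L) {c : History L T}
    (hc : c ∈ stCycles L T) (y : STASite L) :
    Even ((((supp c).map stLinkEmb).filter fun a => y ∈ stEnds a).card) := by
  classical
  rw [Finset.filter_map, Finset.card_map]
  by_cases hy : y ∈ Set.range (stSiteOf : STSite L T → STASite L)
  · obtain ⟨x, rfl⟩ := hy
    have h := congrFun hc x
    change stSyn L T c x = 0 at h
    rw [eq_sum_single_supp c, stSyn_sum, Finset.sum_apply] at h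
    simp only [stSyn_single hL] at h
    rw [Finset.sum_boole] at h
    have : ((supp c).filter fun ℓ => stSiteOf x ∈ stEnds (stLinkOf ℓ)) =
        (supp c).filter ((fun a => stSiteOf x ∈ stEnds a) ∘ stLinkEmb) := rfl
    rw [← this]
    exact ZMod.natCast_eq_zero_iff_even.1 h
  · have : (supp c).filter ((fun a => y ∈ stEnds a) ∘ stLinkEmb) = ∅ := by
      rw [Finset.filter_eq_empty_iff]
      intro ℓ _ h
      exact hy (mem_range_stSiteOf_of_mem_stEnds ℓ h)
    rw [this, Finset.card_empty]
    exact ⟨0, rfl⟩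

/-! ### Self-avoiding lattice paths in the window -/

/-- A self-avoiding lattice path: the sites `0, …, |w|` are distinct.
[cite: DennisEtAl2002, §5.2 (self-avoiding paths on the lattice)] -/
def IsSTLatticeSAW (x : STASite L) (w : List (Fin 3 × Bool)) : Prop :=
  ∀ i j, i ≤ w.length → j ≤ w.length → stPos x w i = stPos x w j → i = j

/-- Every site of a path starting in the window whose links lie in the window is in the window.
[cite: DennisEtAl2002, §4.2 (time slices 0, …, T)] -/
theorem stPos_mem_range [NeZero L] {x : STASite L} {w : List (Fin 3 × Bool)}
    (hx : x ∈ Set.range (stSiteOf : STSite L T → STASite L))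
    (hsub : ↑(stPolygonEdges x w) ⊆ Set.range (stLinkOf : STLink L T → STALink L))
    {i : ℕ} (hi : i ≤ w.length) : stPos x w i ∈ Set.range (stSiteOf : STSite L T → STASite L) := by
  rcases Nat.eq_zero_or_pos i with rfl | hpos
  · rwa [stPos_zero]
  · have hk : i - 1 < w.length := by omega
    obtain ⟨ℓ, hℓ⟩ := hsub (Finset.mem_image.2 ⟨i - 1, Finset.mem_range.2 hk, rfl⟩)
    refine mem_range_stSiteOf_of_mem_stEnds ℓ ?_
    rw [hℓ, stEnds_stEdgeAt x w hk, Sym2.mem_iff, show i - 1 + 1 = i by omega]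
    exact Or.inr rfl

/-- A self-avoiding lattice path in the window has fewer steps than the window has sites.
[cite: DennisEtAl2002, §5.2 (self-avoiding paths on the lattice)] -/
theorem IsSTLatticeSAW.length_lt [NeZero L] {x : STASite L} {w : List (Fin 3 × Bool)}
    (h : IsSTLatticeSAW x w) (hx : x ∈ Set.range (stSiteOf : STSite L T → STASite L))
    (hsub : ↑(stPolygonEdges x w) ⊆ Set.range (stLinkOf : STLink L T → STALink L)) :
    w.length < Fintype.card (STSite L T) := by
  classical
  have hmaps : ∀ i ∈ range (w.length + 1), stPos x w i ∈ (univ : Finset (STSite L T)).image stSiteOf := by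
    intro i hi
    obtain ⟨x₀, hx₀⟩ := stPos_mem_range hx hsub (Nat.le_of_lt_succ (Finset.mem_range.1 hi))
    exact Finset.mem_image.2 ⟨x₀, Finset.mem_univ _, hx₀⟩
  have hinj : Set.InjOn (stPos x w) (range (w.length + 1) : Finset ℕ) := by
    intro i hi j hj hij
    exact h i j (Nat.le_of_lt_succ (Finset.mem_range.1 hi)) (Nat.le_of_lt_succ (Finset.mem_range.1 hj)) hij
  have h1 := Finset.card_le_card_of_injOn (stPos x w) hmaps hinj
  rw [Finset.card_range] at h1
  have h2 : ((univ : Finset (STSite L T)).image stSiteOf).card ≤ Fintype.card (STSite L T) :=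
    Finset.card_image_le.trans (by rw [Finset.card_univ])
  omega

/-- **A non-empty set of links of the window meeting every site an even number of times contains
a self-avoiding polygon** (`L ≥ 3`). Take a longest self-avoiding lattice path whose links lie in
`S`; its last site carries a second link of `S`, and the step along it must revisit an earlier site
(by maximality), not the previous one (that would be the same link), closing up a polygon.
[cite: DennisEtAl2002, §5.2 ("this cycle contains … a self-avoiding closed loop")] -/
theorem exists_stPolygon_subset [NeZero L] (hL : 3 ≤ L) (S : Finset (STALink L)) (hne : S.Nonempty)
    (hS : ↑S ⊆ Set.range (stLinkOf : STLink L T → STALink L))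
    (hdeg : ∀ y : STASite L, Even ((S.filter fun a => y ∈ stEnds a).card)) :
    ∃ (x : STASite L) (w : List (Fin 3 × Bool)), IsSTPolygon x w ∧ stPolygonEdges x w ⊆ S := by
  classical
  set N := Fintype.card (STSite L T) with hN
  set V₀ : Finset (STASite L) := (univ : Finset (STSite L T)).image stSiteOf with hV₀
  have hV₀mem : ∀ {y : STASite L}, y ∈ Set.range (stSiteOf : STSite L T → STASite L) → y ∈ V₀ := by
    rintro y ⟨x₀, rfl⟩
    exact Finset.mem_image.2 ⟨x₀, Finset.mem_univ _, rfl⟩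
  set A : Finset (STASite L × List (Fin 3 × Bool)) :=
    (V₀ ×ˢ (range N).biUnion (fun n => Word.words 3 n)).filter
      (fun vw => IsSTLatticeSAW vw.1 vw.2 ∧ stPolygonEdges vw.1 vw.2 ⊆ S) with hA
  have hmemA : ∀ (v : STASite L) (w : List (Fin 3 × Bool)),
      v ∈ Set.range (stSiteOf : STSite L T → STASite L) →
      IsSTLatticeSAW v w → stPolygonEdges v w ⊆ S → (v, w) ∈ A := by
    intro v w hv h1 h2
    rw [hA, Finset.mem_filter, Finset.mem_product, Finset.mem_biUnion]
    have hsub' : ↑(stPolygonEdges v w) ⊆ Set.range (stLinkOf : STLink L T → STALink L) :=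
      fun a ha => hS (h2 ha)
    exact ⟨⟨hV₀mem hv, w.length, Finset.mem_range.2 (h1.length_lt hv hsub'), Word.mem_words.2 rfl⟩, h1, h2⟩
  -- the one-link paths show `A` has an element of length 1
  obtain ⟨a₀, ha₀⟩ := hne
  obtain ⟨c₀, hc₀⟩ := exists_stStepLink_eq_of_mem_stEnds (stFstEnd_mem_stEnds a₀)
  have hy₀range : stFstEnd a₀ ∈ Set.range (stSiteOf : STSite L T → STASite L) := by
    obtain ⟨ℓ₀, hℓ₀⟩ := hS ha₀
    exact mem_range_stSiteOf_of_mem_stEnds ℓ₀ (hℓ₀ ▸ stFstEnd_mem_stEnds a₀)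
  have h1A : (stFstEnd a₀, [c₀]) ∈ A := by
    refine hmemA _ _ hy₀range ?_ ?_
    · intro i j hi hj hij
      simp only [List.length_singleton] at hi hj
      rcases Nat.le_one_iff_eq_zero_or_eq_one.1 hi with rfl | rfl <;>
        rcases Nat.le_one_iff_eq_zero_or_eq_one.1 hj with rfl | rfl
      · rfl
      · exact absurd hij.symm (stPos_succ_ne (by omega) (stFstEnd a₀) [c₀] (i := 0) (by simp))
      · exact absurd hij (stPos_succ_ne (by omega) (stFstEnd a₀) [c₀] (i := 0) (by simp))
      · rfl
    · intro a ha
      rw [stPolygonEdges, Finset.mem_image] at ha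
      obtain ⟨k, hk, rfl⟩ := ha
      simp only [List.length_singleton, Finset.mem_range, Nat.lt_one_iff] at hk
      subst hk
      have he : stEdgeAt (stFstEnd a₀) [c₀] 0 = a₀ := by
        rw [stEdgeAt, stPos_zero]
        exact hc₀
      rw [he]
      exact ha₀
  have hAne : A.Nonempty := ⟨_, h1A⟩
  obtain ⟨⟨v, w⟩, hvw, hmax⟩ := A.exists_max_image (fun vw => vw.2.length) hAne
  dsimp only at hvw hmax
  rw [hA, Finset.mem_filter, Finset.mem_product] at hvw
  obtain ⟨⟨hvV₀, -⟩, hsaw, hsub⟩ := hvw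
  dsimp only at hsaw hsub hvV₀
  have hvrange : v ∈ Set.range (stSiteOf : STSite L T → STASite L) := by
    obtain ⟨x₀, -, hx₀⟩ := Finset.mem_image.1 hvV₀
    exact ⟨x₀, hx₀⟩
  have hm1 : 1 ≤ w.length := by simpa using hmax _ h1A
  -- the last link and a second link of `S` at the last site `x`
  set m := w.length with hm
  set x := stPos v w m with hx
  have hlast : stEdgeAt v w (m - 1) ∈ S :=
    hsub (Finset.mem_image.2 ⟨m - 1, Finset.mem_range.2 (by omega), rfl⟩)
  have hxlast : x ∈ stEnds (stEdgeAt v w (m - 1)) := by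
    rw [stEnds_stEdgeAt v w (by omega), show m - 1 + 1 = m by omega, Sym2.mem_iff]
    exact Or.inr rfl
  obtain ⟨a', ha'F, hne'⟩ : ∃ a' ∈ S.filter (fun a => x ∈ stEnds a), a' ≠ stEdgeAt v w (m - 1) := by
    refine Finset.exists_mem_ne ?_ _
    have hin : stEdgeAt v w (m - 1) ∈ S.filter (fun a => x ∈ stEnds a) :=
      Finset.mem_filter.2 ⟨hlast, hxlast⟩
    obtain ⟨r, hr⟩ := hdeg x
    have hpos : 0 < (S.filter (fun a => x ∈ stEnds a)).card := Finset.card_pos.2 ⟨_, hin⟩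
    omega
  rw [Finset.mem_filter] at ha'F
  obtain ⟨ha'S, hxa'⟩ := ha'F
  obtain ⟨c', hc'⟩ := exists_stStepLink_eq_of_mem_stEnds hxa'
  -- the extended path
  set w' := w ++ [c'] with hw'
  have hlen' : w'.length = m + 1 := by simp [hw', hm]
  have hpos' : ∀ i, i ≤ m → stPos v w' i = stPos v w i := fun i hi => stPos_append_left v w [c'] hi
  have hy : stPos v w' (m + 1) = x + stProj (stepVec c') := by
    have := stPos_append_right v w [c'] 1
    rw [← hm] at this
    rw [this, stPos_succ _ _ (by simp), stPos_zero]
    simp [hx]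
  have hedge' : ∀ k, k < m → stEdgeAt v w' k = stEdgeAt v w k := fun k hk => stEdgeAt_append_left v w [c'] hk
  have hedgem : stEdgeAt v w' m = a' := by
    rw [hw', hm, stEdgeAt_append_single, ← hx, hc']
  have hsub' : stPolygonEdges v w' ⊆ S := by
    intro a ha
    rw [stPolygonEdges, Finset.mem_image] at ha
    obtain ⟨k, hk, rfl⟩ := ha
    rw [Finset.mem_range, hlen'] at hk
    rcases lt_or_eq_of_le (Nat.le_of_lt_succ hk) with hk' | rfl
    · rw [hedge' k hk']
      exact hsub (Finset.mem_image.2 ⟨k, Finset.mem_range.2 hk', rfl⟩)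
    · rw [hedgem]; exact ha'S
  -- by maximality the extended path is not self-avoiding: its new site is an old one
  have hnot : ¬ IsSTLatticeSAW v w' := by
    intro h
    have := hmax _ (hmemA v w' hvrange h hsub')
    simp [hlen'] at this
  obtain ⟨i, him, hiy⟩ : ∃ i, i ≤ m ∧ stPos v w' (m + 1) = stPos v w i := by
    simp only [IsSTLatticeSAW, not_forall, exists_prop] at hnot
    obtain ⟨i, j, hi, hj, hij, hne⟩ := hnot
    rw [hlen'] at hi hj
    rcases lt_or_eq_of_le hi with hi' | rfl
    · rcases lt_or_eq_of_le hj with hj' | rfl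
      · exact absurd (hsaw i j (by omega) (by omega) (by rwa [hpos' i (by omega), hpos' j (by omega)] at hij)) hne
      · exact ⟨i, by omega, by rw [← hij, hpos' i (by omega)]⟩
    · rcases lt_or_eq_of_le hj with hj' | rfl
      · exact ⟨j, by omega, by rw [hij, hpos' j (by omega)]⟩
      · exact absurd rfl hne
  -- the revisited site is neither the last site nor the one before it
  have hi_ne_m : i ≠ m := by
    rintro rfl
    rw [hy, ← hx, add_eq_left] at hiy
    exact stProj_stepVec_ne_zero (by omega) c' hiy
  have hi_ne_pred : i ≠ m - 1 := by
    rintro rfl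
    apply hne'
    rw [← hc']
    apply stEnds_injective hL
    rw [stEnds_stStepLink, stEnds_stEdgeAt v w (by omega), show m - 1 + 1 = m by omega, ← hx, ← hy, hiy,
      Sym2.eq_swap]
  have hi2 : i + 2 ≤ m := by omega
  -- the polygon: from the site `i`, the rest of the extended path
  have hdropLen : (w'.drop i).length = m + 1 - i := by rw [List.length_drop, hlen']
  have hposD : ∀ k, stPos (stPos v w i) (w'.drop i) k = stPos v w' (i + k) := by
    intro k
    rw [← hpos' i him]
    exact stPos_drop v w' (by rw [hlen']; omega) k
  refine ⟨stPos v w i, w'.drop i, ⟨?_, ?_, ?_⟩, ?_⟩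
  · rw [hdropLen]; omega
  · rw [hdropLen, hposD, show i + (m + 1 - i) = m + 1 by omega, hiy]
  · intro k k' hk hk' hkk'
    rw [hdropLen] at hk hk'
    rw [hposD, hposD, hpos' _ (by omega), hpos' _ (by omega)] at hkk'
    have := hsaw _ _ (by omega) (by omega) hkk'
    omega
  · intro a ha
    rw [stPolygonEdges, Finset.mem_image] at ha
    obtain ⟨k, hk, rfl⟩ := ha
    rw [Finset.mem_range, hdropLen] at hk
    rw [← hpos' i him, stEdgeAt_drop v w' (by rw [hlen']; omega)]
    exact hsub' (Finset.mem_image.2 ⟨i + k, Finset.mem_range.2 (by rw [hlen']; omega), rfl⟩)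

/-! ### A cycle with non-trivial projection contains such a polygon -/

/-- Adding the history of a polygon whose links lie in the support of `c` removes exactly those
links. [cite: DennisEtAl2002, §4.4 (chains add modulo 2)] -/
private theorem map_supp_add_stPolygonChain [NeZero L] {c : History L T} {x : STASite L}
    {w : List (Fin 3 × Bool)} (hP : IsSTPolygon x w) (hsub : stPolygonEdges x w ⊆ (supp c).map stLinkEmb) :
    (supp (c + stPolygonChain x w)).map stLinkEmb = (supp c).map stLinkEmb \ stPolygonEdges x w := by
  classical
  ext a
  rw [Finset.mem_sdiff, Finset.mem_map, Finset.mem_map]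
  constructor
  · rintro ⟨ℓ, hℓ, rfl⟩
    rw [mem_supp', Pi.add_apply, stPolygonChain_apply hP.stEdgeAt_injOn] at hℓ
    by_cases h : stLinkOf ℓ ∈ stPolygonEdges x w
    · exfalso
      obtain ⟨ℓ', hℓ', he⟩ := Finset.mem_map.1 (hsub h)
      rw [stLinkEmb_apply] at he
      have hℓℓ : ℓ' = ℓ := stLinkOf_injective he
      subst hℓℓ
      have hc : c ℓ' = 1 := zmod2_eq_one_of_ne_zero (mem_supp'.1 hℓ')
      rw [if_pos h, hc] at hℓ
      exact hℓ (by decide)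
    · rw [if_neg h, add_zero] at hℓ
      exact ⟨⟨ℓ, mem_supp'.2 hℓ, rfl⟩, h⟩
  · rintro ⟨⟨ℓ, hℓ, rfl⟩, h⟩
    refine ⟨ℓ, ?_, rfl⟩
    rw [stLinkEmb_apply] at h
    rw [mem_supp', Pi.add_apply, stPolygonChain_apply hP.stEdgeAt_injOn, if_neg h, add_zero]
    exact mem_supp'.1 hℓ

/-- **A space-time cycle with homologically non-trivial projection contains a self-avoiding
polygon with homologically non-trivial projection** (`L ≥ 3`): peel self-avoiding polygons off
the cycle; since the histories with trivial projection form a subspace, one of them is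
non-trivial. [cite: DennisEtAl2002, §5.2 ("E + E_min contains … a homologically nontrivial self-avoiding closed loop") with §6.1] -/
theorem exists_stPolygon_not_mem_stTrivial [NeZero L] (hL : 3 ≤ L) {c : History L T}
    (hc : c ∈ stCycles L T) (hnt : c ∉ stTrivial L T) :
    ∃ (x : STASite L) (w : List (Fin 3 × Bool)), IsSTPolygon x w ∧
      stPolygonEdges x w ⊆ (supp c).map stLinkEmb ∧ (stPolygonChain x w : History L T) ∉ stTrivial L T := by
  classical
  induction hn : (supp c).card using Nat.strong_induction_on generalizing c with
  | _ n ih =>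
  have hrange : ↑((supp c).map stLinkEmb) ⊆ Set.range (stLinkOf : STLink L T → STALink L) := by
    intro a ha
    obtain ⟨ℓ, -, rfl⟩ := Finset.mem_map.1 (Finset.mem_coe.1 ha)
    exact ⟨ℓ, rfl⟩
  -- `c ≠ 0`, so its support is non-empty
  have hne : ((supp c).map stLinkEmb).Nonempty := by
    rw [Finset.map_nonempty, Finset.nonempty_iff_ne_empty]
    intro h0
    apply hnt
    have : c = 0 := by
      funext ℓ
      by_contra h
      have : ℓ ∈ supp c := mem_supp'.2 h
      rw [h0] at this
      exact Finset.notMem_empty _ this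
    rw [this]
    exact (stTrivialSubmodule L T).zero_mem
  have hdeg := even_card_filter_of_mem_stCycles (by omega) hc
  obtain ⟨x, w, hP, hsub⟩ := exists_stPolygon_subset hL _ hne hrange hdeg
  have hsubr : ↑(stPolygonEdges x w) ⊆ Set.range (stLinkOf : STLink L T → STALink L) :=
    fun a ha => hrange (hsub ha)
  by_cases hq : (stPolygonChain x w : History L T) ∈ stTrivial L T
  · -- peel it off and recurse
    have hqc : (stPolygonChain x w : History L T) ∈ stCycles L T :=
      stPolygonChain_mem_stCycles (by omega) hP.closed hsubr
    set c' := c + stPolygonChain x w with hc'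
    have hc'c : c' ∈ stCycles L T := by
      change stSyn L T c' = 0
      have h1 : stSyn L T c = 0 := hc
      have h2 : stSyn L T (stPolygonChain x w) = 0 := hqc
      rw [hc', stSyn_add, h1, h2, add_zero]
    have hc'nt : c' ∉ stTrivial L T := by
      intro h
      apply hnt
      have : c = c' + stPolygonChain x w := by
        rw [hc', add_assoc]
        funext ℓ
        simp only [Pi.add_apply, zmod2_add_self, add_zero]
      rw [this]
      exact (stTrivialSubmodule L T).add_mem h hq
    have hcard : (supp c').card < n := by
      have h1 : ((supp c').map stLinkEmb).card = ((supp c).map stLinkEmb \ stPolygonEdges x w).card := by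
        rw [hc', map_supp_add_stPolygonChain hP hsub]
      rw [Finset.card_map, Finset.card_sdiff_of_subset hsub, Finset.card_map, hP.card_stPolygonEdges, hn] at h1
      have h3 := hP.three_le
      have : (stPolygonEdges x w).card ≤ ((supp c).map stLinkEmb).card := Finset.card_le_card hsub
      rw [hP.card_stPolygonEdges, Finset.card_map, hn] at this
      omega
    obtain ⟨x', w', hP', hsub', hq'⟩ := ih _ hcard hc'c hc'nt rfl
    refine ⟨x', w', hP', hsub'.trans ?_, hq'⟩
    rw [hc', map_supp_add_stPolygonChain hP hsub]
    exact Finset.sdiff_subset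
  · exact ⟨x, w, hP, hsub, hq⟩

/-! ### At least half of the links of the polygon are faulty -/

/-- **The half-weight inequality** (DKLP eq. (e_ineq)), for binary vectors on any finite index
set: if `|E'| ≤ |E' + q|` and `supp q ⊆ supp(E' + E)`, then at least half of the support of `q`
lies in `supp E` ("there can be no more than `H/2` links [of `E_min`] on this path … therefore
there must be at least `H/2` links [of `E`]"). [cite: DennisEtAl2002, §5.2 eq. (e_ineq)] -/
theorem card_supp_le_two_mul_card_inter {V : Type*} [Fintype V] [DecidableEq V] {e e' q : V → ZMod 2}
    (hPc : supp q ⊆ supp (e' + e)) (hmin : hammingNorm e' ≤ hammingNorm (e' + q)) :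
    (supp q).card ≤ 2 * (supp q ∩ supp e).card := by
  set P := supp q with hP
  have hq : ∀ ℓ, q ℓ = if ℓ ∈ P then 1 else 0 := by
    intro ℓ
    split_ifs with h
    · exact zmod2_eq_one_of_ne_zero (mem_supp'.1 h)
    · by_contra h'
      exact h (mem_supp'.2 h')
  have hx_off : supp (e' + q) \ P = supp e' \ P := by
    ext ℓ
    simp only [Finset.mem_sdiff, mem_supp', Pi.add_apply]
    constructor
    · rintro ⟨h1, h2⟩
      rw [hq ℓ, if_neg h2, add_zero] at h1
      exact ⟨h1, h2⟩
    · rintro ⟨h1, h2⟩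
      rw [hq ℓ, if_neg h2, add_zero]
      exact ⟨h1, h2⟩
  have hx_on : supp (e' + q) ∩ P = P ∩ supp e := by
    ext ℓ
    simp only [Finset.mem_inter, mem_supp', Pi.add_apply]
    constructor
    · rintro ⟨h1, h2⟩
      refine ⟨h2, ?_⟩
      have hee : e' ℓ + e ℓ ≠ 0 := by have h' := mem_supp'.1 (hPc h2); exact h'
      rw [hq ℓ, if_pos h2] at h1
      have he' : e' ℓ = 0 := by
        have : e' ℓ + 1 ≠ 0 := h1
        revert this; generalize e' ℓ = a; revert a; decide
      exact (zmod2_eq_zero_iff_of_add_ne_zero hee).1 he'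
    · rintro ⟨h2, h1⟩
      refine ⟨?_, h2⟩
      have hee : e' ℓ + e ℓ ≠ 0 := by have h' := mem_supp'.1 (hPc h2); exact h'
      have he' : e' ℓ = 0 := by
        by_contra h
        have := (zmod2_eq_zero_iff_of_add_ne_zero (by rwa [add_comm] at hee)).2 h
        exact h1 this
      rw [hq ℓ, if_pos h2, he', zero_add]
      exact one_ne_zero
  have he'_on : supp e' ∩ P = P \ supp e := by
    ext ℓ
    simp only [Finset.mem_inter, Finset.mem_sdiff, mem_supp']
    constructor
    · rintro ⟨h1, h2⟩
      have hee : e' ℓ + e ℓ ≠ 0 := by have h' := mem_supp'.1 (hPc h2); exact h'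
      refine ⟨h2, ?_⟩
      rw [not_not]
      by_contra h
      exact h1 ((zmod2_eq_zero_iff_of_add_ne_zero hee).2 h)
    · rintro ⟨h2, h1⟩
      have hee : e' ℓ + e ℓ ≠ 0 := by have h' := mem_supp'.1 (hPc h2); exact h'
      rw [not_not] at h1
      refine ⟨?_, h2⟩
      intro h
      exact ((zmod2_eq_zero_iff_of_add_ne_zero hee).1 h) h1
  have h1 : (supp (e' + q)).card = (supp e' \ P).card + (P ∩ supp e).card := by
    rw [← Finset.card_sdiff_add_card_inter (supp (e' + q)) P, hx_off, hx_on]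
  have h2 : (supp e').card = (supp e' \ P).card + (P \ supp e).card := by
    rw [← Finset.card_sdiff_add_card_inter (supp e') P, he'_on]
  have h3 : (P \ supp e).card + (P ∩ supp e).card = P.card := Finset.card_sdiff_add_card_inter P (supp e)
  have hmin' : (supp e').card ≤ (supp (e' + q)).card := hmin
  omega

/-- **Failure of minimum-weight space-time decoding forces a long half-faulty self-avoiding
polygon.** If a minimum-weight decoder `D` for the `T`-round memory experiment on the `L × L`
toric code (`L ≥ 3`) fails on the error history `E`, there is a self-avoiding polygon of the
window with `ℓ ≥ L` links ("At a minimum, the homologically nontrivial (self-avoiding) path must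
contain at least `L` horizontal links" — via `cycle_weight_ge_holds` on its projection), at least
half of which are faulty links of `E`. [cite: DennisEtAl2002, §5.2 (H ≥ L and eq. (e_ineq))] -/
theorem exists_stPolygon_of_failure [NeZero L] (hL : 3 ≤ L) {D : STDecoder L T}
    (hD : D.IsMinWeight (stSyn L T) (stCycles L T) hammingNorm) {E : History L T}
    (hfail : ¬ D.Corrects (stSyn L T) (stTrivial L T) E) :
    ∃ (x : STASite L) (w : List (Fin 3 × Bool)), IsSTPolygon x w ∧
      ↑(stPolygonEdges x w) ⊆ Set.range (stLinkOf : STLink L T → STALink L) ∧ L ≤ w.length ∧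
      w.length ≤ 2 * (stLinks (stPolygonEdges x w) ∩ supp E).card := by
  classical
  set E' := D (stSyn L T E) with hE'
  have hc : E' + E ∈ stCycles L T := hD.add_mem E
  have hnt : E' + E ∉ stTrivial L T := hfail
  obtain ⟨x, w, hP, hsub, hq⟩ := exists_stPolygon_not_mem_stTrivial hL hc hnt
  have hsubr : ↑(stPolygonEdges x w) ⊆ Set.range (stLinkOf : STLink L T → STALink L) := by
    intro a ha
    obtain ⟨ℓ, -, rfl⟩ := Finset.mem_map.1 (hsub ha)
    exact ⟨ℓ, rfl⟩
  have hqc : (stPolygonChain x w : History L T) ∈ stCycles L T :=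
    stPolygonChain_mem_stCycles (by omega) hP.closed hsubr
  refine ⟨x, w, hP, hsubr, ?_, ?_⟩
  · -- the projection is a non-trivial cycle of the toric code: `L ≤ |Π q| ≤ |q| = |w|`
    have h1 := le_hammingNorm_of_stCycle_not_trivial (E := (stPolygonChain x w : History L T)) hqc hq
    rwa [hammingNorm_stPolygonChain hP hsubr] at h1
  · -- minimality of `E'` against `E' + q`, which has the same syndrome
    have hsyn : stSyn L T (E' + stPolygonChain x w) = stSyn L T E := by
      have h1 : stSyn L T (E' + E) = 0 := hc
      have h2 : stSyn L T (stPolygonChain x w) = 0 := hqc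
      rw [stSyn_add, h2, add_zero]
      rw [stSyn_add] at h1
      funext y
      exact zmod2_eq_of_add_eq_zero (congrFun h1 y)
    have hmin : hammingNorm E' ≤ hammingNorm (E' + stPolygonChain x w) := by
      have := hD.weight_le (E' + stPolygonChain x w)
      rwa [hsyn] at this
    have hPc : supp (stPolygonChain x w : History L T) ⊆ supp (E' + E) := by
      intro ℓ hℓ
      rw [supp_stPolygonChain hP.stEdgeAt_injOn, mem_stLinks] at hℓ
      obtain ⟨ℓ', hℓ', he⟩ := Finset.mem_map.1 (hsub hℓ)
      rw [stLinkEmb_apply] at he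
      rwa [← stLinkOf_injective he]
    have h := card_supp_le_two_mul_card_inter hPc hmin
    rw [supp_stPolygonChain hP.stEdgeAt_injOn, card_stLinks hsubr, hP.card_stPolygonEdges] at h
    exact h

end ToricCode

end Literature.InformationTheory.QuantumCodes
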